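import Summits.QuantumFields.YangMills.Theorems.BalabanUVNodesN19TameHellingerLetterRegimeFree
import Summits.QuantumFields.YangMills.Theorems.BalabanUVNodesN20HellingerRoadNullClasses

/-!
# BalabanUVNodes ∕ node N20 (NE7b) — THE TAME-TILT (H)-LETTER WITH NULL ∕ ONE-SIDED CLASSES IN THE WILD SET: non-negative class weights, positive on the TAME
# classes only; and the V-side of the hellinger road END TO END for non-negative weights (wild mass + ONE tame tilt + (R′) + (R‑c) ⇒ `HybridNE7`)

Cell `pub-ymgap` (HUMAN RULING D-0062 Track A ∕ director-ym R399 (3a) width seats), WIDTH SEAT `pub-ymgap-dag-n20-w5` (node n20 = NE7b), generation g6,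
CLAIM-4 ∕ INTENT-4 (bus).  Key item K3⁸ `SpineGivenEndpointR13SepCoPHV` (stmt-QuantumFields-27366; skeleton of record v6 b4e55110ab73e679, stub `stub_expansion13HV`),
K3⁷ stmt-QuantumFields-20544 aside; filed `--kind proof --supports … --as helper`.  COUNT-NEUTRAL.  THEOREMS ONLY (0 `def`, 0 `instance`, 0 `notation`, 0 `sorry`).
ADDITIVE — imports dag-n19-w4 g8's p627322 `…N19TameHellingerLetterRegimeFree` (`one_sub_affinity_classLaw_le_of_originDisc_tilt`, `exists_forall_two_le_of_summable_one_div`;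
through it p618660 `…N19TameConditionedHellingerLetter`: `one_sub_affinity_le_wildMass_add_conditioned`, `affinity_conditioned_classLaw_eq_restricted`, `classLaw_mass_eq`)
and this seat's g6 `…N20HellingerRoadNullClasses` (p641090: `exists_hybridNE7_of_affinityDefectLetter_and_response_of_nonneg`) — cited BY NAME; modifies nothing.
dag-n19-w4's seat is ■ since 12:02Z (g8, 3∕3); this is the null-class EDITION of its socket, not a restatement: the positivity hypothesis moves off the wild set.

WHY.  This seat's g6 files (p640016 ∕ p641090) removed STRICT positivity from the hellinger road's ENDPOINT: at the reading of record one-sided σ-keys carry a class weight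
`≡ 0` under one run, so only `0 ≤ A, B` can be keyed there.  The road's V-side SUPPLIERS of the (H) letter — dag-n19-w4's tame-tilt letter p627322 and everything composed
on it (this seat's refresh ∕ cover roads p629153 ∕ p637046) — still ask `0 < A, B` on the WHOLE carrier, although the tilt reads `log B − log A` on the TAME classes
`T ∖ W` only and the wild classes are paid by their MASS.  This file moves the positivity hypothesis to where it is read: non-negative weights on `T`, positive on
`T ∖ W` — i.e. every null ∕ one-sided class is declared WILD (its one-run mass is then part of `wm_K`, which (H) pays anyway: p640016
`classLaw_nullSet_le_one_sub_affinity_sq`).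
* §1 [folklore] ★ `one_sub_affinity_classLaw_le_wildMass_add_restricted_of_nonneg` — p618660's R2 (tame conditioning) for `0 ≤ A, B` on `T`, `0 < A, B` on `T ∖ W ≠ ∅`:
  `1 − 𝒜_T ≤ max(p(W), q(W)) + (1 − 𝒜 of the restricted laws)` (same law-level kernel `one_sub_affinity_le_wildMass_add_conditioned`).
* §2 [folklore] ★★ `one_sub_affinity_classLaw_le_wildMass_add_tameTilt_of_nonneg` — + ONE origin-disc tilt branch on the tame classes (p627322 §1 BY NAME on `S := T ∖ W`):
  `1 − 𝒜_T ≤ max(p(W), q(W)) + 2𝔅∕r²` · `sqrt_…_of_nonneg` (Hellinger currency).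
* §3 [folklore] ★★★ `affinityDefectLetter_of_tameTilt_of_nonneg` — ALONG `K`: p627322 §3's binder list with `hA ∕ hB` WEAKENED to `0 ≤` on `T K` (every source) plus
  `0 <` on the tame classes `T K ∖ W K t` (on the window) ⇒ `∃ η ≥ 0, Σ√η_K < ∞, 1 − 𝒜_K(t) ≤ η_K` (`η_K = wm_K + 2𝔅∕r_K² (+1 on the finite head)`).
* §4 ★★★ `exists_hybridNE7_of_wildMass_tameTilt_and_response_of_nonneg` — THE V-SIDE END TO END for non-negative weights: §3 fed to p641090's ∃-road (head (L), dictionary,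
  differentiability, (R′), (R‑c)) ⇒ `∃ η Wsh shA shB, (H) ∧ Σ√η<∞ ∧ budget ∧ HybridNE7 l₀ vol T A B ∅ 0 shA shB Wsh (K ↦ l₀(R₁ K + 2√(2η_K)√χ)∕vol)`.
* §5 A6 toy `toy_affinityDefectLetter_nullClassWild` — p641090's two-class carrier (class `false` NULL under run B) with `W := {false}`: every antecedent of §3 met
  (tame tilt `φ(z) = z·log(1 + 4^{−(K+1)})` on radius `2^K`, `𝔅 = 1`), the (H) letter EXHIBITED — the old socket's `hB` is false there (`toy_oldRoad_hB_fails`).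
READING (located, nothing proposed).  At the record the V-side bill per tuple becomes: wild sets `W K t ⊆ classSet₁₃` CONTAINING every null ∕ one-sided σ-key, the two one-run
wild-mass bounds `wm_K` with `Σ√wm < ∞`, radii `Σ 1∕r_K < ∞`, ONE bound `𝔅`, ONE analytic tilt branch of the TAME class sums per `(K, t)` — NODE O's objects; nothing typable
against the datum before a skeleton exposes the window key (plan's `kr := wkey`).

HONEST FRAMING.  [folklore] one-variable complex analysis + finite sums on HYPOTHESIS SHAPES, composed by name; EVERY letter (wild masses (V‑a), radii (V‑b) = (YG), the tilt
branch (KR), (R′), (R‑c), differentiability, the two-sided live class) is a HYPOTHESIS produced by nobody — (V‑b)∕(R′) are two-run statements, UNPRINTED for d = 4; NO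
estimate of Bałaban's programme is proved; nothing of Bałaban's asserted or instantiated (no `Provisos₁₃SepCoPH` tuple — K0⁷ OPEN); NE7 ∕ NE7b ∕ NE7c NOT PRINTED as
two-run statements for d = 4 and NOT proved; N19′ ∕ N20 ∕ N21 NOT discharged; K3⁸ OPEN (v6 STANDS), K3⁷ aside, neither claimed; no summit statement is proved by this
seat; counts UNMOVED (typed 28∕28 · discharged 5∕28; 5∕27 excl. NODE O).  One finite four-torus programme at fixed ε — NOT ℝ⁴, NOT infinite volume, NOT OS, NOT a mass
gap, NOT the Clay problem (R4 closes the conditional finite-𝕋⁴ rung `BalabanLadder.UV` only).  0 `def`; 0 `sorry`; standard axioms; no cite tags.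
-/

noncomputable section

namespace Summit.QuantumFields.YangMills.BalabanUVNodes.N20TameTiltLetterNullClasses

open Finset
open Literature.MathematicalPhysics.QuantumFieldTheory.Balaban1983to89
open T4MatchingAssembly (HybridNE7)
open Summit.QuantumFields.YangMills.BalabanUVNodes.N19TameConditionedHellingerLetter
  (one_sub_affinity_le_wildMass_add_conditioned affinity_conditioned_classLaw_eq_restricted classLaw_mass_eq)
open Summit.QuantumFields.YangMills.BalabanUVNodes.N19TameHellingerLetterRegimeFree
  (one_sub_affinity_classLaw_le_of_originDisc_tilt exists_forall_two_le_of_summable_one_div)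
open Summit.QuantumFields.YangMills.BalabanUVNodes.N20HellingerRoadNullClasses (exists_hybridNE7_of_affinityDefectLetter_and_response_of_nonneg)

variable {ι : Type*}

/-! ## §1 Tame conditioning for non-negative weights, positive on the tame classes [folklore] -/

section OneKey
variable [DecidableEq ι] {T : Finset ι} {A B : ι → ℝ}

/-- **★ R2 (TAME CONDITIONING) FOR NON-NEGATIVE WEIGHTS** [folklore; p618660 `one_sub_affinity_classLaw_le_wildMass_add_restricted` with positivity asked on the TAME
classes only].  Class weights `A, B ≥ 0` on `T`, `> 0` on `T ∖ W` (nonempty), `W ⊆ T` ⇒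
`1 − Σ_T √(p_A p_B) ≤ max(Σ_W A∕Σ_T A, Σ_W B∕Σ_T B) + (1 − Σ_{T∖W} √((A∕Σ_{T∖W}A)(B∕Σ_{T∖W}B)))` — null ∕ one-sided classes may sit in `W`, where only their MASS is read. -/
theorem one_sub_affinity_classLaw_le_wildMass_add_restricted_of_nonneg {W : Finset ι} (hW : W ⊆ T)
    (hA0 : ∀ τ ∈ T, 0 ≤ A τ) (hB0 : ∀ τ ∈ T, 0 ≤ B τ) (hA : ∀ τ ∈ T \ W, 0 < A τ) (hB : ∀ τ ∈ T \ W, 0 < B τ) (hne : (T \ W).Nonempty) :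
    1 - ∑ τ ∈ T, Real.sqrt ((A τ / ∑ σ ∈ T, A σ) * (B τ / ∑ σ ∈ T, B σ))
      ≤ max ((∑ τ ∈ W, A τ) / ∑ σ ∈ T, A σ) ((∑ τ ∈ W, B τ) / ∑ σ ∈ T, B σ)
        + (1 - ∑ τ ∈ T \ W, Real.sqrt ((A τ / ∑ σ ∈ T \ W, A σ) * (B τ / ∑ σ ∈ T \ W, B σ))) := by
  have hSA : 0 < ∑ σ ∈ T \ W, A σ := sum_pos hA hne
  have hSB : 0 < ∑ σ ∈ T \ W, B σ := sum_pos hB hne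
  have hZA : 0 < ∑ σ ∈ T, A σ := lt_of_lt_of_le hSA (sum_le_sum_of_subset_of_nonneg sdiff_subset fun τ hτ _ => hA0 τ hτ)
  have hZB : 0 < ∑ σ ∈ T, B σ := lt_of_lt_of_le hSB (sum_le_sum_of_subset_of_nonneg sdiff_subset fun τ hτ _ => hB0 τ hτ)
  have hp : ∀ τ ∈ T, 0 ≤ A τ / ∑ σ ∈ T, A σ := fun τ hτ => div_nonneg (hA0 τ hτ) hZA.le
  have hq : ∀ τ ∈ T, 0 ≤ B τ / ∑ σ ∈ T, B σ := fun τ hτ => div_nonneg (hB0 τ hτ) hZB.le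
  have hp1 : ∑ τ ∈ T, A τ / ∑ σ ∈ T, A σ = 1 := by rw [← sum_div, div_self hZA.ne']
  have hq1 : ∑ τ ∈ T, B τ / ∑ σ ∈ T, B σ = 1 := by rw [← sum_div, div_self hZB.ne']
  have hP : 0 < ∑ τ ∈ T \ W, A τ / ∑ σ ∈ T, A σ := by rw [← sum_div]; exact div_pos hSA hZA
  have hQ : 0 < ∑ τ ∈ T \ W, B τ / ∑ σ ∈ T, B σ := by rw [← sum_div]; exact div_pos hSB hZB
  have h := one_sub_affinity_le_wildMass_add_conditioned (p := fun τ => A τ / ∑ σ ∈ T, A σ)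
    (q := fun τ => B τ / ∑ σ ∈ T, B σ) hW hp hq hp1 hq1 hP hQ
  rw [affinity_conditioned_classLaw_eq_restricted (T \ W) hZA.ne' hZB.ne',
    classLaw_mass_eq (T := T) (A := A) W, classLaw_mass_eq (T := T) (A := B) W] at h
  exact h

/-! ## §2 + ONE origin-disc tilt branch on the tame classes [folklore] -/

/-- **★★ THE ONE-`(K,t)` HELLINGER LETTER FROM WILD MASS AND ONE TAME TILT, NON-NEGATIVE WEIGHTS** [folklore; p627322
`one_sub_affinity_classLaw_le_wildMass_add_tameTilt` with positivity moved to the tame classes].  `A, B ≥ 0` on `T`, `> 0` on `T ∖ W`; ONE branch `φ` of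
`log (Σ_{T∖W} A e^{z(log B − log A)} ∕ Σ_{T∖W} A)` on `closedBall 0 r`, `r ≥ 2`, `‖φ‖ ≤ 𝔅` ⇒ `1 − Σ_T √(p_A p_B) ≤ max(Σ_W A∕Σ_T A, Σ_W B∕Σ_T B) + 2𝔅∕r²`
(`T ∖ W ≠ ∅` is forced by `hexp` at `0`). -/
theorem one_sub_affinity_classLaw_le_wildMass_add_tameTilt_of_nonneg {W : Finset ι} (hW : W ⊆ T)
    (hA0 : ∀ τ ∈ T, 0 ≤ A τ) (hB0 : ∀ τ ∈ T, 0 ≤ B τ) (hA : ∀ τ ∈ T \ W, 0 < A τ) (hB : ∀ τ ∈ T \ W, 0 < B τ)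
    {r 𝔅 : ℝ} (hr : 2 ≤ r) (φ : ℂ → ℂ) (hφ : DifferentiableOn ℂ φ (Metric.closedBall 0 r))
    (hexp : ∀ s ∈ Metric.closedBall (0:ℂ) r, Complex.exp (φ s)
      = (∑ τ ∈ T \ W, (A τ : ℂ) * Complex.exp (s * ((Real.log (B τ) - Real.log (A τ) : ℝ) : ℂ))) / ∑ τ ∈ T \ W, (A τ : ℂ))
    (hb : ∀ s ∈ Metric.closedBall (0:ℂ) r, ‖φ s‖ ≤ 𝔅) :
    1 - ∑ τ ∈ T, Real.sqrt ((A τ / ∑ σ ∈ T, A σ) * (B τ / ∑ σ ∈ T, B σ))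
      ≤ max ((∑ τ ∈ W, A τ) / ∑ σ ∈ T, A σ) ((∑ τ ∈ W, B τ) / ∑ σ ∈ T, B σ) + 2 * 𝔅 / r ^ 2 := by
  have hr0 : 0 < r := by linarith
  have hne : (T \ W).Nonempty := by
    rcases (T \ W).eq_empty_or_nonempty with h0 | h1
    · exfalso
      have h := hexp 0 (Metric.mem_closedBall_self hr0.le)
      rw [h0, sum_empty, sum_empty, zero_div] at h
      exact Complex.exp_ne_zero _ h
    · exact h1
  have h1 := one_sub_affinity_classLaw_le_wildMass_add_restricted_of_nonneg hW hA0 hB0 hA hB hne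
  have h2 := one_sub_affinity_classLaw_le_of_originDisc_tilt (S := T \ W) hA hB hr φ hφ hexp hb
  linarith

/-- **… in HELLINGER (square-root) currency** [folklore]: under the same hypotheses
`√(1 − Σ_T √(p_A p_B)) ≤ √(max(Σ_W A∕Σ_T A, Σ_W B∕Σ_T B)) + √(2𝔅)∕r`. -/
theorem sqrt_one_sub_affinity_classLaw_le_wildMass_add_tameTilt_of_nonneg {W : Finset ι} (hW : W ⊆ T)
    (hA0 : ∀ τ ∈ T, 0 ≤ A τ) (hB0 : ∀ τ ∈ T, 0 ≤ B τ) (hA : ∀ τ ∈ T \ W, 0 < A τ) (hB : ∀ τ ∈ T \ W, 0 < B τ)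
    {r 𝔅 : ℝ} (hr : 2 ≤ r) (φ : ℂ → ℂ) (hφ : DifferentiableOn ℂ φ (Metric.closedBall 0 r))
    (hexp : ∀ s ∈ Metric.closedBall (0:ℂ) r, Complex.exp (φ s)
      = (∑ τ ∈ T \ W, (A τ : ℂ) * Complex.exp (s * ((Real.log (B τ) - Real.log (A τ) : ℝ) : ℂ))) / ∑ τ ∈ T \ W, (A τ : ℂ))
    (hb : ∀ s ∈ Metric.closedBall (0:ℂ) r, ‖φ s‖ ≤ 𝔅) :
    Real.sqrt (1 - ∑ τ ∈ T, Real.sqrt ((A τ / ∑ σ ∈ T, A σ) * (B τ / ∑ σ ∈ T, B σ)))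
      ≤ Real.sqrt (max ((∑ τ ∈ W, A τ) / ∑ σ ∈ T, A σ) ((∑ τ ∈ W, B τ) / ∑ σ ∈ T, B σ)) + Real.sqrt (2 * 𝔅) / r := by
  have hr0 : 0 < r := by linarith
  have h := one_sub_affinity_classLaw_le_wildMass_add_tameTilt_of_nonneg hW hA0 hB0 hA hB hr φ hφ hexp hb
  have hZA : 0 ≤ ∑ σ ∈ T, A σ := sum_nonneg hA0
  have hm0 : 0 ≤ max ((∑ τ ∈ W, A τ) / ∑ σ ∈ T, A σ) ((∑ τ ∈ W, B τ) / ∑ σ ∈ T, B σ) :=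
    le_trans (div_nonneg (sum_nonneg fun τ hτ => hA0 τ (hW hτ)) hZA) (le_max_left _ _)
  have h𝔅 : 0 ≤ 𝔅 := (norm_nonneg _).trans (hb 0 (Metric.mem_closedBall_self hr0.le))
  have htil : 0 ≤ 2 * 𝔅 / r ^ 2 := by positivity
  have hsub : ∀ {a b : ℝ}, 0 ≤ a → 0 ≤ b → Real.sqrt (a + b) ≤ Real.sqrt a + Real.sqrt b := fun {a b} ha hb => by
    rw [Real.sqrt_le_left (by positivity)]
    nlinarith [Real.sq_sqrt ha, Real.sq_sqrt hb, mul_nonneg (Real.sqrt_nonneg a) (Real.sqrt_nonneg b)]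
  calc Real.sqrt (1 - ∑ τ ∈ T, Real.sqrt ((A τ / ∑ σ ∈ T, A σ) * (B τ / ∑ σ ∈ T, B σ)))
      ≤ Real.sqrt (max ((∑ τ ∈ W, A τ) / ∑ σ ∈ T, A σ) ((∑ τ ∈ W, B τ) / ∑ σ ∈ T, B σ) + 2 * 𝔅 / r ^ 2) :=
        Real.sqrt_le_sqrt h
    _ ≤ Real.sqrt (max ((∑ τ ∈ W, A τ) / ∑ σ ∈ T, A σ) ((∑ τ ∈ W, B τ) / ∑ σ ∈ T, B σ)) + Real.sqrt (2 * 𝔅 / r ^ 2) := hsub hm0 htil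
    _ = Real.sqrt (max ((∑ τ ∈ W, A τ) / ∑ σ ∈ T, A σ) ((∑ τ ∈ W, B τ) / ∑ σ ∈ T, B σ)) + Real.sqrt (2 * 𝔅) / r := by
        rw [Real.sqrt_div' _ (by positivity : (0:ℝ) ≤ r ^ 2), Real.sqrt_sq hr0.le]

end OneKey

/-! ## §3 ALONG `K`: the (H) letter from wild mass + radii + ONE tame tilt branch, non-negative weights [folklore] -/

section Summation
variable [DecidableEq ι] {l₀ : ℝ}

/-- **★★★ THE HELLINGER LETTER ALONG `K` FROM WILD MASS AND ONE TAME TILT, NON-NEGATIVE WEIGHTS** [folklore; p627322 `affinityDefectLetter_of_tameTilt` with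
`hA ∕ hB` WEAKENED: `0 ≤ A, B` on `T K` at every source, `0 < A, B` on the TAME classes `T K ∖ W K t` on the window — every null ∕ one-sided class sits in `W K t`].
Wild sets `W K t ⊆ T K`, per-key bounds `wm_K` on BOTH one-run wild masses with `Σ_K √wm_K < ∞` ((V‑a)), radii `r_K > 0` with `Σ 1∕r_K < ∞` ((V‑b)), ONE bound `𝔅 ≥ 0`,
at every `(K,t)` ONE branch of `log (Σ_{T∖W} A e^{z(log B − log A)} ∕ Σ_{T∖W} A)` on `closedBall 0 r_K` bounded by `𝔅` ⇒ `∃ η ≥ 0`, `Σ_K √η_K < ∞`,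
`1 − Σ_{T K} √(p_{A,K,t}·p_{B,K,t}) ≤ η_K` on the window (`η_K = wm_K + 2𝔅∕r_K²`, `+1` on the finite head `r_K < 2`). -/
theorem affinityDefectLetter_of_tameTilt_of_nonneg (T : ℕ → Finset ι) (A B : ℕ → ℝ → ι → ℝ)
    (hA0 : ∀ (K : ℕ) (t : ℝ), ∀ τ ∈ T K, 0 ≤ A K t τ) (hB0 : ∀ (K : ℕ) (t : ℝ), ∀ τ ∈ T K, 0 ≤ B K t τ)
    (W : ℕ → ℝ → Finset ι) (hW : ∀ K t, W K t ⊆ T K)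
    (hA : ∀ K t, |t| ≤ l₀ → ∀ τ ∈ T K \ W K t, 0 < A K t τ) (hB : ∀ K t, |t| ≤ l₀ → ∀ τ ∈ T K \ W K t, 0 < B K t τ)
    (wm : ℕ → ℝ) (hwm : ∀ K, 0 ≤ wm K)
    (hwildA : ∀ K t, |t| ≤ l₀ → (∑ τ ∈ W K t, A K t τ) / (∑ σ ∈ T K, A K t σ) ≤ wm K)
    (hwildB : ∀ K t, |t| ≤ l₀ → (∑ τ ∈ W K t, B K t τ) / (∑ σ ∈ T K, B K t σ) ≤ wm K)
    (hws : Summable fun K => Real.sqrt (wm K))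
    (r : ℕ → ℝ) (hr : ∀ K, 0 < r K) (hrs : Summable fun K => 1 / r K)
    {𝔅 : ℝ} (h𝔅 : 0 ≤ 𝔅)
    (htilt : ∀ K t, |t| ≤ l₀ → ∃ φ : ℂ → ℂ,
      DifferentiableOn ℂ φ (Metric.closedBall 0 (r K)) ∧
      (∀ s ∈ Metric.closedBall (0:ℂ) (r K), Complex.exp (φ s)
        = (∑ τ ∈ T K \ W K t, (A K t τ : ℂ) * Complex.exp (s * ((Real.log (B K t τ) - Real.log (A K t τ) : ℝ) : ℂ)))
            / ∑ τ ∈ T K \ W K t, (A K t τ : ℂ)) ∧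
      (∀ s ∈ Metric.closedBall (0:ℂ) (r K), ‖φ s‖ ≤ 𝔅)) :
    ∃ η : ℕ → ℝ, (∀ K, 0 ≤ η K) ∧ Summable (fun K => Real.sqrt (η K)) ∧
      ∀ K t, |t| ≤ l₀ →
        1 - ∑ τ ∈ T K, Real.sqrt ((A K t τ / ∑ σ ∈ T K, A K t σ) * (B K t τ / ∑ σ ∈ T K, B K t σ)) ≤ η K := by
  -- the finite head: `r_K ≥ 2` from some `K₁` on (p627322's device, verbatim)
  obtain ⟨K₁, hK₁⟩ := exists_forall_two_le_of_summable_one_div hr hrs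
  refine ⟨fun K => wm K + 2 * 𝔅 / r K ^ 2 + (if K < K₁ then (1:ℝ) else 0), ?_, ?_, ?_⟩
  · intro K
    have hwmK := hwm K
    have hrK := hr K
    have hind : 0 ≤ (if K < K₁ then (1:ℝ) else 0) := by split_ifs <;> norm_num
    positivity
  · have hsub : ∀ {a b : ℝ}, 0 ≤ a → 0 ≤ b → Real.sqrt (a + b) ≤ Real.sqrt a + Real.sqrt b := fun {a b} ha hb => by
      rw [Real.sqrt_le_left (by positivity)]
      nlinarith [Real.sq_sqrt ha, Real.sq_sqrt hb, mul_nonneg (Real.sqrt_nonneg a) (Real.sqrt_nonneg b)]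
    have hhead : Summable fun K => (if K < K₁ then (1:ℝ) else 0) := by
      refine summable_of_ne_finset_zero (s := Finset.range K₁) fun K hK => ?_
      rw [Finset.mem_range] at hK
      simp [hK]
    refine Summable.of_nonneg_of_le (fun K => Real.sqrt_nonneg _) (fun K => ?_)
      ((hws.add (hrs.mul_left (Real.sqrt (2 * 𝔅)))).add hhead)
    have hrK := hr K
    have hwmK := hwm K
    have hind : 0 ≤ (if K < K₁ then (1:ℝ) else 0) := by split_ifs <;> norm_num
    have hind' : Real.sqrt (if K < K₁ then (1:ℝ) else 0) = (if K < K₁ then (1:ℝ) else 0) := by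
      split_ifs <;> simp
    have hq0 : (0:ℝ) ≤ 2 * 𝔅 / r K ^ 2 := by positivity
    have hs0 : (0:ℝ) ≤ wm K + 2 * 𝔅 / r K ^ 2 := by positivity
    calc Real.sqrt (wm K + 2 * 𝔅 / r K ^ 2 + (if K < K₁ then (1:ℝ) else 0))
        ≤ Real.sqrt (wm K + 2 * 𝔅 / r K ^ 2) + Real.sqrt (if K < K₁ then (1:ℝ) else 0) := hsub hs0 hind
      _ ≤ (Real.sqrt (wm K) + Real.sqrt (2 * 𝔅 / r K ^ 2)) + (if K < K₁ then (1:ℝ) else 0) := by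
          rw [hind']; exact add_le_add (hsub hwmK hq0) le_rfl
      _ = Real.sqrt (wm K) + Real.sqrt (2 * 𝔅) * (1 / r K) + (if K < K₁ then (1:ℝ) else 0) := by
          rw [Real.sqrt_div' _ (by positivity : (0:ℝ) ≤ r K ^ 2), Real.sqrt_sq hrK.le]; ring
  · intro K t ht
    beta_reduce
    have hind : 0 ≤ (if K < K₁ then (1:ℝ) else 0) := by split_ifs <;> norm_num
    have hrK := hr K
    by_cases hK : K < K₁
    · -- on the finite head the letter is the trivial bound `1 − 𝒜 ≤ 1`
      simp only [hK, if_true]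
      have h0 : 0 ≤ ∑ τ ∈ T K, Real.sqrt ((A K t τ / ∑ σ ∈ T K, A K t σ) * (B K t τ / ∑ σ ∈ T K, B K t σ)) :=
        sum_nonneg fun _ _ => Real.sqrt_nonneg _
      have : 0 ≤ 2 * 𝔅 / r K ^ 2 := by positivity
      linarith [hwm K]
    · simp only [hK, if_false, add_zero]
      obtain ⟨φ, hφ, he, hbφ⟩ := htilt K t ht
      have h1 := one_sub_affinity_classLaw_le_wildMass_add_tameTilt_of_nonneg (T := T K) (hW K t) (hA0 K t) (hB0 K t) (hA K t ht) (hB K t ht)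
        (hK₁ K (not_lt.1 hK)) φ hφ he hbφ
      have hmax : max ((∑ τ ∈ W K t, A K t τ) / ∑ σ ∈ T K, A K t σ) ((∑ τ ∈ W K t, B K t τ) / ∑ σ ∈ T K, B K t σ) ≤ wm K :=
        max_le (hwildA K t ht) (hwildB K t ht)
      linarith

end Summation

/-! ## §4 THE V-SIDE END TO END FOR NON-NEGATIVE WEIGHTS: wild mass + ONE tame tilt + the R-side ⇒ `HybridNE7` [by-name through p641090] -/

section Road
variable [DecidableEq ι] {l₀ vol : ℝ} {T : ℕ → Finset ι} {A B : ℕ → ℝ → ι → ℝ}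

/-- **★★★ `HybridNE7` FROM WILD MASS, ONE TAME TILT AND THE ENDPOINT RESPONSE, NON-NEGATIVE WEIGHTS** [folklore + by-name].  §3's (H) letter fed to this seat's
p641090 `exists_hybridNE7_of_affinityDefectLetter_and_response_of_nonneg`: class weights `≥ 0` at every source, positive on the TAME classes on the window, a two-sided
live class at every `(K,t)` (head (L), NECESSARY by p641090 `twoSided_of_hybridNE7`), differentiable on the window, the E1∕E2 dictionary; wild masses `Σ√wm < ∞`, radii
`Σ 1∕r < ∞`, ONE bound `𝔅`, ONE tame tilt branch per `(K,t)`; (R′) `Σ R₁ < ∞`, (R‑c) ⇒ `∃ η Wsh shA shB` with the (H) letter, `Σ√η < ∞`, `0 ≤ Wsh ≤ √(2η)`, `Wsh < 1`, and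
`HybridNE7 l₀ vol T A B (fun _ _ => ∅) (fun _ => 0) shA shB Wsh (K ↦ l₀·(R₁ K + 2√(2η_K)√χ)∕vol)`. -/
theorem exists_hybridNE7_of_wildMass_tameTilt_and_response_of_nonneg (hl₀ : 0 ≤ l₀) (hvol : 0 < vol)
    (hA0 : ∀ (K : ℕ) (t : ℝ), ∀ τ ∈ T K, 0 ≤ A K t τ) (hB0 : ∀ (K : ℕ) (t : ℝ), ∀ τ ∈ T K, 0 ≤ B K t τ)
    (hlive : ∀ (K : ℕ) (t : ℝ), |t| ≤ l₀ → ∃ σ ∈ T K, 0 < A K t σ ∧ 0 < B K t σ)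
    {Z : ℕ → ℝ → ℝ} (hZA' : ∀ (K : ℕ) (t : ℝ), |t| ≤ l₀ → Z K t = ∑ τ ∈ T K, A K t τ)
    (hZB' : ∀ (K : ℕ) (t : ℝ), |t| ≤ l₀ → Z (K + 1) t = ∑ τ ∈ T K, B K t τ)
    {A' B' : ℕ → ℝ → ι → ℝ}
    (hdA : ∀ (K : ℕ) (s : ℝ), |s| ≤ l₀ → ∀ τ ∈ T K, HasDerivAt (fun u => A K u τ) (A' K s τ) s)
    (hdB : ∀ (K : ℕ) (s : ℝ), |s| ≤ l₀ → ∀ τ ∈ T K, HasDerivAt (fun u => B K u τ) (B' K s τ) s)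
    -- the V-side: wild sets holding every null ∕ one-sided class, wild masses, radii, ONE tame tilt branch
    (W : ℕ → ℝ → Finset ι) (hW : ∀ K t, W K t ⊆ T K)
    (hA : ∀ K t, |t| ≤ l₀ → ∀ τ ∈ T K \ W K t, 0 < A K t τ) (hB : ∀ K t, |t| ≤ l₀ → ∀ τ ∈ T K \ W K t, 0 < B K t τ)
    (wm : ℕ → ℝ) (hwm : ∀ K, 0 ≤ wm K)
    (hwildA : ∀ K t, |t| ≤ l₀ → (∑ τ ∈ W K t, A K t τ) / (∑ σ ∈ T K, A K t σ) ≤ wm K)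
    (hwildB : ∀ K t, |t| ≤ l₀ → (∑ τ ∈ W K t, B K t τ) / (∑ σ ∈ T K, B K t σ) ≤ wm K)
    (hws : Summable fun K => Real.sqrt (wm K))
    (r : ℕ → ℝ) (hr : ∀ K, 0 < r K) (hrs : Summable fun K => 1 / r K)
    {𝔅 : ℝ} (h𝔅 : 0 ≤ 𝔅)
    (htilt : ∀ K t, |t| ≤ l₀ → ∃ φ : ℂ → ℂ,
      DifferentiableOn ℂ φ (Metric.closedBall 0 (r K)) ∧
      (∀ s ∈ Metric.closedBall (0:ℂ) (r K), Complex.exp (φ s)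
        = (∑ τ ∈ T K \ W K t, (A K t τ : ℂ) * Complex.exp (s * ((Real.log (B K t τ) - Real.log (A K t τ) : ℝ) : ℂ)))
            / ∑ τ ∈ T K \ W K t, (A K t τ : ℂ)) ∧
      (∀ s ∈ Metric.closedBall (0:ℂ) (r K), ‖φ s‖ ≤ 𝔅))
    -- the R-side: (R′) + (R‑c)
    {R₁ : ℕ → ℝ} {χ : ℝ} {m : ℕ → ℝ → ℝ}
    (hR : ∀ (K : ℕ) (s : ℝ), |s| ≤ l₀ →
      |∑ τ ∈ T K, B K s τ / (∑ σ ∈ T K, B K s σ) * (B' K s τ / B K s τ - A' K s τ / A K s τ)| ≤ R₁ K)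
    (hRs : Summable R₁)
    (hχ : ∀ (K : ℕ) (s : ℝ), |s| ≤ l₀ →
      ∑ τ ∈ T K, (A K s τ / (∑ σ ∈ T K, A K s σ) + B K s τ / (∑ σ ∈ T K, B K s σ)) / 2 * (A' K s τ / A K s τ - m K s) ^ 2 ≤ χ) :
    ∃ (η Wsh : ℕ → ℝ) (shA shB : ℕ → ℝ → ι → ℝ),
      (∀ (K : ℕ) (t : ℝ), |t| ≤ l₀ →
        1 - ∑ τ ∈ T K, Real.sqrt ((A K t τ / ∑ σ ∈ T K, A K t σ) * (B K t τ / ∑ σ ∈ T K, B K t σ)) ≤ η K) ∧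
      Summable (fun K => Real.sqrt (η K)) ∧
      (∀ K, 0 ≤ Wsh K ∧ Wsh K ≤ Real.sqrt (2 * η K) ∧ Wsh K < 1) ∧
      HybridNE7 l₀ vol T A B (fun _ _ => ∅) (fun _ => 0) shA shB Wsh
        (fun K => l₀ * (R₁ K + 2 * Real.sqrt (2 * η K) * Real.sqrt χ) / vol) :=
  exists_hybridNE7_of_affinityDefectLetter_and_response_of_nonneg hl₀ hvol hA0 hB0 hlive hZA' hZB' hdA hdB
    (affinityDefectLetter_of_tameTilt_of_nonneg T A B hA0 hB0 W hW hA hB wm hwm hwildA hwildB hws r hr hrs h𝔅 htilt) hR hRs hχ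

end Road

/-! ## §5 Toy (A6): the (H) letter on a carrier with a NULL class declared wild [folklore] -/

section Toy

/-- **★ TOY — §3 FIRES WITH A NULL CLASS IN THE WILD SET.**  p641090's two-class carrier on `Bool` (run A: `true ↦ 1`, `false ↦ 4^{−K}`; run B: `true ↦ 1 + 4^{−(K+1)}`,
`false ↦ 0` — NULL), wild set `W := {false}`: the tame classes are `{true}` (both runs positive there), the wild masses are `≤ 4^{−K}` (run A) and `0` (run B), the tame
tilt is the entire function `φ(z) = z·log(1 + 4^{−(K+1)})` with `‖φ‖ ≤ 2^K·4^{−(K+1)} ≤ 1` on radius `2^K` — every antecedent of `affinityDefectLetter_of_tameTilt_of_nonneg`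
met and the (H) letter EXHIBITED; the old socket's `hB` is false on this carrier (p641090 `toy_oldRoad_hB_fails`). -/
theorem toy_affinityDefectLetter_nullClassWild :
    ∃ η : ℕ → ℝ, (∀ K, 0 ≤ η K) ∧ Summable (fun K => Real.sqrt (η K)) ∧
      ∀ (K : ℕ) (t : ℝ), |t| ≤ (1:ℝ) →
        1 - ∑ τ ∈ (Finset.univ : Finset Bool),
          Real.sqrt (((fun (K : ℕ) (_ : ℝ) (b : Bool) => if b then (1:ℝ) else (((1:ℝ) / 2) ^ K) ^ 2) K t τ
              / ∑ σ ∈ (Finset.univ : Finset Bool), (fun (K : ℕ) (_ : ℝ) (b : Bool) => if b then (1:ℝ) else (((1:ℝ) / 2) ^ K) ^ 2) K t σ)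
            * ((fun (K : ℕ) (_ : ℝ) (b : Bool) => if b then 1 + (((1:ℝ) / 2) ^ (K + 1)) ^ 2 else 0) K t τ
              / ∑ σ ∈ (Finset.univ : Finset Bool), (fun (K : ℕ) (_ : ℝ) (b : Bool) => if b then 1 + (((1:ℝ) / 2) ^ (K + 1)) ^ 2 else 0) K t σ)) ≤ η K := by
  classical
  set A : ℕ → ℝ → Bool → ℝ := fun K _ b => if b then (1:ℝ) else (((1:ℝ) / 2) ^ K) ^ 2 with hAdef
  set B : ℕ → ℝ → Bool → ℝ := fun K _ b => if b then 1 + (((1:ℝ) / 2) ^ (K + 1)) ^ 2 else 0 with hBdef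
  have hAt : ∀ K t, A K t true = 1 := fun K t => by simp [hAdef]
  have hAf : ∀ K t, A K t false = (((1:ℝ) / 2) ^ K) ^ 2 := fun K t => by simp [hAdef]
  have hBt : ∀ K t, B K t true = 1 + (((1:ℝ) / 2) ^ (K + 1)) ^ 2 := fun K t => by simp [hBdef]
  have hBf : ∀ K t, B K t false = 0 := fun K t => by simp [hBdef]
  have hA0 : ∀ (K : ℕ) (t : ℝ), ∀ τ ∈ (Finset.univ : Finset Bool), 0 ≤ A K t τ := by
    intro K t τ _; cases τ
    · rw [hAf K t]; positivity
    · rw [hAt K t]; norm_num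
  have hB0 : ∀ (K : ℕ) (t : ℝ), ∀ τ ∈ (Finset.univ : Finset Bool), 0 ≤ B K t τ := by
    intro K t τ _; cases τ
    · rw [hBf K t]
    · rw [hBt K t]; positivity
  have hsd : (Finset.univ : Finset Bool) \ {false} = {true} := by decide
  have hA : ∀ (K : ℕ) (t : ℝ), |t| ≤ (1:ℝ) → ∀ τ ∈ (Finset.univ : Finset Bool) \ {false}, 0 < A K t τ := by
    intro K t _ τ hτ; rw [hsd, mem_singleton] at hτ; subst hτ; rw [hAt K t]; norm_num
  have hB : ∀ (K : ℕ) (t : ℝ), |t| ≤ (1:ℝ) → ∀ τ ∈ (Finset.univ : Finset Bool) \ {false}, 0 < B K t τ := by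
    intro K t _ τ hτ; rw [hsd, mem_singleton] at hτ; subst hτ; rw [hBt K t]; positivity
  have hsumA : ∀ (K : ℕ) (t : ℝ), ∑ τ ∈ (Finset.univ : Finset Bool), A K t τ = 1 + (((1:ℝ) / 2) ^ K) ^ 2 := by
    intro K t; rw [Fintype.sum_bool, hAt K t, hAf K t]
  have hsumB : ∀ (K : ℕ) (t : ℝ), ∑ τ ∈ (Finset.univ : Finset Bool), B K t τ = 1 + (((1:ℝ) / 2) ^ (K + 1)) ^ 2 := by
    intro K t; rw [Fintype.sum_bool, hBt K t, hBf K t, add_zero]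
  -- wild masses: run A `4^{−K}∕(1 + 4^{−K}) ≤ 4^{−K}`, run B `0`
  have hwildA : ∀ (K : ℕ) (t : ℝ), |t| ≤ (1:ℝ) →
      (∑ τ ∈ ({false} : Finset Bool), A K t τ) / (∑ σ ∈ (Finset.univ : Finset Bool), A K t σ) ≤ (((1:ℝ) / 2) ^ K) ^ 2 := by
    intro K t _
    rw [sum_singleton, hAf K t, hsumA K t]
    exact div_le_self (sq_nonneg _) (by nlinarith [sq_nonneg (((1:ℝ) / 2) ^ K)])
  have hwildB : ∀ (K : ℕ) (t : ℝ), |t| ≤ (1:ℝ) →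
      (∑ τ ∈ ({false} : Finset Bool), B K t τ) / (∑ σ ∈ (Finset.univ : Finset Bool), B K t σ) ≤ (((1:ℝ) / 2) ^ K) ^ 2 := by
    intro K t _
    rw [sum_singleton, hBf K t, zero_div]
    exact sq_nonneg _
  have hws : Summable fun K : ℕ => Real.sqrt ((((1:ℝ) / 2) ^ K) ^ 2) := by
    have : (fun K : ℕ => Real.sqrt ((((1:ℝ) / 2) ^ K) ^ 2)) = fun K => ((1:ℝ) / 2) ^ K := by
      funext K; exact Real.sqrt_sq (pow_nonneg (by norm_num) K)
    rw [this]; exact summable_geometric_two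
  -- radii `2^K` and the entire tame tilt `φ(z) = z · log(1 + 4^{−(K+1)})`, bounded by `1`
  have hr : ∀ K : ℕ, (0:ℝ) < 2 ^ K := fun K => by positivity
  have hrs : Summable fun K : ℕ => 1 / (2:ℝ) ^ K := by
    have : (fun K : ℕ => 1 / (2:ℝ) ^ K) = fun K => ((1:ℝ) / 2) ^ K := by funext K; rw [one_div_pow]
    rw [this]; exact summable_geometric_two
  have htilt : ∀ (K : ℕ) (t : ℝ), |t| ≤ (1:ℝ) → ∃ φ : ℂ → ℂ,
      DifferentiableOn ℂ φ (Metric.closedBall 0 ((2:ℝ) ^ K)) ∧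
      (∀ s ∈ Metric.closedBall (0:ℂ) ((2:ℝ) ^ K), Complex.exp (φ s)
        = (∑ τ ∈ (Finset.univ : Finset Bool) \ {false}, (A K t τ : ℂ) * Complex.exp (s * ((Real.log (B K t τ) - Real.log (A K t τ) : ℝ) : ℂ)))
            / ∑ τ ∈ (Finset.univ : Finset Bool) \ {false}, (A K t τ : ℂ)) ∧
      (∀ s ∈ Metric.closedBall (0:ℂ) ((2:ℝ) ^ K), ‖φ s‖ ≤ 1) := by
    intro K t _
    set h : ℝ := Real.log (1 + (((1:ℝ) / 2) ^ (K + 1)) ^ 2) - Real.log 1 with hh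
    refine ⟨fun z => z * (h : ℂ), (differentiable_id.mul (differentiable_const _)).differentiableOn, fun s _ => ?_, fun s hs => ?_⟩
    · rw [hsd, sum_singleton, sum_singleton, hAt K t, hBt K t, hh]
      push_cast
      rw [one_mul, div_one]
    · have hε : 0 ≤ (((1:ℝ) / 2) ^ (K + 1)) ^ 2 := sq_nonneg _
      have hlog : 0 ≤ h ∧ h ≤ (((1:ℝ) / 2) ^ (K + 1)) ^ 2 := by
        rw [hh, Real.log_one, sub_zero]
        exact ⟨Real.log_nonneg (by linarith), (Real.log_le_sub_one_of_pos (by linarith)).trans (by linarith)⟩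
      have hs' : ‖s‖ ≤ (2:ℝ) ^ K := by simpa using hs
      have hK : (2:ℝ) ^ K * (((1:ℝ) / 2) ^ (K + 1)) ^ 2 ≤ 1 := by
        have h2 : (2:ℝ) ^ K * ((1:ℝ) / 2) ^ K = 1 := by rw [← mul_pow]; norm_num
        have e : (2:ℝ) ^ K * (((1:ℝ) / 2) ^ (K + 1)) ^ 2 = ((2:ℝ) ^ K * ((1:ℝ) / 2) ^ K) * (((1:ℝ) / 2) ^ K * (1 / 4)) := by
          rw [pow_succ]; ring
        rw [e, h2, one_mul]
        have : ((1:ℝ) / 2) ^ K ≤ 1 := pow_le_one₀ (by norm_num) (by norm_num)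
        linarith
      calc ‖s * (h : ℂ)‖ = ‖s‖ * h := by rw [norm_mul, Complex.norm_real, Real.norm_of_nonneg hlog.1]
        _ ≤ (2:ℝ) ^ K * (((1:ℝ) / 2) ^ (K + 1)) ^ 2 := mul_le_mul hs' hlog.2 hlog.1 (by positivity)
        _ ≤ 1 := hK
  exact affinityDefectLetter_of_tameTilt_of_nonneg (l₀ := 1) (fun _ => (Finset.univ : Finset Bool)) A B hA0 hB0 (fun _ _ => {false})
    (fun _ _ => Finset.subset_univ _) hA hB (fun K => (((1:ℝ) / 2) ^ K) ^ 2) (fun K => sq_nonneg _) hwildA hwildB hws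
    (fun K => (2:ℝ) ^ K) hr hrs zero_le_one htilt

end Toy

end Summit.QuantumFields.YangMills.BalabanUVNodes.N20TameTiltLetterNullClasses

end
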